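import Literature.IUT.HodgeArakelov.ThetaSettingCor112ModelTateUnconditional
import Literature.IUT.HodgeArakelov.ThetaSettingHcharYOfParityAtModelTate
import Literature.IUT.HodgeArakelov.ThetaSettingDeltaCharacteristicEtThThm510
import Literature.IUT.HodgeArakelov.ModelMonoThetaModulesLim
import Literature.AnabelianGeometry.EtaleTheta.Discharge.Sec2Cor218iThetaSubquotients
import Literature.AnabelianGeometry.EtaleTheta.SettingModelTateDeltaTheta
import Literature.AnabelianGeometry.EtaleTheta.SettingModelTateEllCoordinates
import Literature.AnabelianGeometry.EtaleTheta.SettingModelTateDoubleUnderline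
import Literature.AnabelianGeometry.EtaleTheta.SettingModelTateInversionXuu
import Literature.AnabelianGeometry.EtaleTheta.SettingModelChiDoubleUnderline
import Literature.AnabelianGeometry.EtaleTheta.Discharge.Sec2Cor219iiiHgenParityAtModelChi
import HarnessLib

/-!
# F-0620 [EtTh] Cor. 2.18 (i) AT THE STAGE-2 TATE MODELS WITHOUT `hextΔ`: the six clauses one by one, and
# `Cor218_i ⟸ hcharY ∧ hΘ` (proof-only; K-L6 row «F0620@1-DIRECT»)

S. Mochizuki, *The étale theta function and its Frobenioid-theoretic manifestations*, Publ. RIMS **45** (2009) [EtTh],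
Cor. 2.18 (i), PRIMS PDF p. 60 (the named fact `RigidData.Cor218_i`, FACT-LIST F-0620) [cite: MochizukiEtTh2009, Cor 2.18(i) p.60];
§1 p. 12 ("`Δ_Θ (≅ Ẑ(1))`", "`Δ^Θ_X`", the quotients `Π^tp_X ↠ (Π^tp_X)^Θ ↠ (Π^tp_X)^ell`) [cite: MochizukiEtTh2009, §1 p.12];
Def. 2.5 (i) p. 39, Prop. 2.2 (ii) p. 37, Prop. 2.12 (i) p. 45 ("`Ker(Δ^Θ_* ↠ Δ^ell_*) = l·Δ_Θ`") [cite: MochizukiEtTh2009, Prop 2.12(i) p.45].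
S. Mochizuki, *Inter-universal Teichmüller theory II*, kurims manuscript (Dec. 2020) §1, Prop. 1.4 p. 27 (the interface clause
"`Π_Ÿ(Π)`", typed as (H1) `hcharY := EtaleThetaDataOfSetting.PiYddCharacteristic`) [claim: Mochizuki2012, status: disputed]
(IUTchII §1 Prop 1.4, kurims p.27).  Cell `abc-iut`, K-L6 slice, row «F0620@1-DIRECT» (abc-iut-L6-lead gen 8, L6 ROWS #4
2026-08-27T03:53Z), seat abc-iut-w6-d028 (gen 11/12).  PROOF-ONLY: no definition, no instance, no new named fact; every input
consumed BY NAME — abc-iut-L2-t8 `DoubleUnderline.rigidData` (`RigidOfSetting`), abc-iut-L2-d1 `rigidData_aug_ker` /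
`rigidData_thetaKer` / `rigidData_lDeltaTheta` / `ThetaSetting.comap_toTheta_deltaTheta` (`Sec2Cor218iThetaSubquotients`),
abc-iut-w5-d233 `ModelTateCarriers.isTopCharacteristic_GtpY_subgroupOf_Huu_modelχq`, abc-iut-w4-d044
`SettingModel.deltaX_characteristic_ofDoubleUnderline_modelχq_holds` (p488629) through
`isTopCharacteristic_deltaTemp_subgroupOf_Huu_of_deltaX_ofDoubleUnderline`, abc-iut-w6-d055
`piYddCharacteristic_iff_isTopCharacteristic` (p495340), abc-iut-L6-d6 `mem_thetaKerχq_iff` / `mem_ellKerχq_iff`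
(`SettingModelTateDeltaTheta`), abc-iut-L2-d1 `levelHom_gfpOf_of_zero_zpow` / `Huuχq`, the test elements `inl_gfpOf_of_one_mem_Huuχq` (`SettingModelTateInversionXuu`) /
`inl_gfpOf_zpow_mem_Huuχq` (`Sec2Cor219iiiHgenParityAtModelChi`).

THE BINDER.  In the K-L6 display of [IUTchII] Cor. 1.12 (ii)(iii) at the Tate model (abc-iut-w4-d043 p477403 … abc-iut-L6-d6
p492626) the F-0620 input is `h218i₁ : (C.rigidData (τ.modAll 1) hC hS h15 L).Cor218_i` with `R.PiX = ↥C.Huu`,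
`C.Huu = Huuχq p 1 2 l hl = dUU l ⋊_{actχq} G_{ℚ_p}` (`Π^tp_{X̲̲}` of the stage-2 model).  `Cor218_i` (`ThetaRigidity.lean`) quantifies
over EVERY bicontinuous automorphism `γ : ↥C.Huu ≃ₜ* ↥C.Huu` — no `Δ`-, `G_K`-, inner- or extension condition — and asks SIX
invariance clauses: (Y̲̲) `GtpY.subgroupOf Huu`, (Ÿ̲̲) `GtpYdd.subgroupOf Huu`, (Δ) `DeltaTemp.subgroupOf Huu`, (Θ)
`toTheta.ker.subgroupOf Huu`, (l·Δ_Θ) the inverse image of `l·Δ_Θ`, (cusps) the labels.  abc-iut-L6-t2's p490266 supplies it from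
the extension hypothesis `hextΔ` (UNDECIDED at the model, abc-iut-w5-d169 2026-08-27T04:04Z).  THIS FILE takes NO extension step:
* §1 (ANY theta setting, any `E`, `C`, `μ`, `L`) `DoubleUnderline.rigidData_cor218_i_of_isTopCharacteristic` — `Cor218_i` of the §1
  model from the six clauses as `IsTopCharacteristic C.Huu (…)` hypotheses; the (l·Δ_Θ) clause RE-KEYED as
  «`Ker(Π^tp_X ↠ (Π^tp_X)^ell) ∩ Π^tp_{X̲̲}`» (`rigidData_lDeltaTheta_eq_ker_toEll_subgroupOf`, by `C.map_toTheta_Huu`).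
* §2 (stage-2 models `ThetaSetting.modelχq p i j hj`, every `E`, every `X̲̲`-choice `C` containing `inl η(b)` and some `inl η(a^n)`)
  `isTopCharacteristic_ker_toEll_subgroupOf_Huu_modelχq_of_thetaKer` — **(Θ) ∧ (Δ) ⟹ (l·Δ_Θ)**: intrinsically
  `Ker(↠ell) ∩ Π^tp_{X̲̲} = {g ∈ Δ^tp_{X̲̲} | ∀ h ∈ Δ^tp_{X̲̲}, ⁅g, h⁆ ∈ Ker(↠Θ)}` (`⊆`: `Δ_Θ` central in `Δ^Θ`; `⊇`: test against
  `η(b)`, `η(a^n)` in Heisenberg coordinates — `x = 0` and `n·y = 0` at every level, hence `y = 0`).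
* §3 `rigidData_cor218_i_modelχq_of_piYddCharacteristic_of_thetaKer` — **F-0620 (empty labelling) ⟸ (Δ) ∧ hcharY ∧ hΘ** at the
  stage-2 models ((Y̲̲) from the tree); at the Tate model's `X̲̲`-choice OF RECORD, where (Δ) is abc-iut-w4-d044's THEOREM,
  `ModelTateCarriers.levelRigid_cor218_i_modelTate_of_piYddCharacteristic_of_thetaKer`: **F-0620 at EVERY level `M` ⟸ hcharY ∧ hΘ**,
  every prime `p` of the record (no `p mod 4` case, no parity theorem, no `hextΔ`).  Since (H1) `hcharY` is ALREADY displayed by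
  p477403 / p492626, the binder `h218i₁` is replaceable by its single conjunct `hΘ`; consumer term (§4 `example` certifies the type):
  `cor112_model_modelTate_section_translates_unconditional p l hl hlp hdvd τ hP (levelRigid_…_of_thetaKer p l hl hlp hdvd τ hcharY hΘ 1)
  hcharY huniq G` — NO telescope twin is filed (abc-iut-L6-lead §F v1.19ds (D)).

WHAT THIS DOES NOT DO.  `hΘ` is NOT decided here in either direction: `Ker(↠Θ) ∩ Π^tp_{X̲̲} = inl(dUU l ∩ γ₃(F̂₂)⁻)` is verbal in
`F̂₂` but not in the closure `Û_l` of `dUU l` (free profinite of rank `l² + 1`), so its stability under `Aut_top(dUU l ⋊ G_{ℚ_p})` is a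
rigidity statement for Galois-compatible automorphisms of `Û_l`, of the same species as abc-iut-w5-d169's `hextΔ` reduction; it is
implied by `hextΔ` (abc-iut-L2-d1 `rigidData_thetaKer_map_eq_of_extends`).  HONEST LABEL: `modelχq` is a SEMI-SYNTHETIC model of the
typed [EtTh] §1 interface (not the tempered `π₁` of a curve): binder-discharge evidence for OUR typed interface, not a statement
about [EtTh] (refereed) in print; F-0620 stays a FACT-policy row; `hcharY`, `hΘ` are DISPLAYED hypotheses, not endorsed; nothing of
[IUTchII] (claim key `Mochizuki2012`, DISPUTED, D-0012) is asserted; no side is taken on [IUTchIII] Cor. 3.12; typed ≠ proved;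
instantiated ≠ endorsed; a reduction is not a verdict; nothing here says abc is proved or refuted.
-/

noncomputable section

open scoped commutatorElement

/-! ## §1. Generic: `Cor218_i` of the §1 model from the six `IsTopCharacteristic` clauses -/

namespace Literature.AnabelianGeometry.EtaleTheta

namespace ThetaSetting

variable {p : ℕ} [Fact p.Prime] {D : ThetaSetting p} {E : D.EtaleThetaData}

namespace EtaleThetaData.DoubleUnderline

variable {l : ℕ} (C : E.DoubleUnderline l) {N : ℕ+}

/-- On `Π^tp_{X̲̲}` the inverse image of `l·Δ_Θ` is the inverse image of `Δ_Θ`: `θ(Π^tp_{X̲̲}) ∩ Δ_Θ = l·Δ_Θ`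
(`C.map_toTheta_Huu`, "`Ker(Δ^Θ_* ↠ Δ^ell_*) = l·Δ_Θ`"). [cite: MochizukiEtTh2009, Prop 2.12(i) p.45] -/
theorem toTheta_mem_lDeltaTheta_iff_of_mem_Huu {x : D.PiTemp} (hx : x ∈ C.Huu) :
    D.toTheta x ∈ D.lDeltaTheta l ↔ D.toTheta x ∈ D.DeltaTheta := by
  refine ⟨fun h => D.lDeltaTheta_le l h, fun h => ?_⟩
  rw [← C.map_toTheta_Huu]
  exact Subgroup.mem_inf.mpr ⟨⟨x, hx, rfl⟩, h⟩

/-- The `lDeltaTheta` of the model rigid data of `X̲̲` IS `Ker(Π^tp_X ↠ (Π^tp_X)^ell) ∩ Π^tp_{X̲̲}` (bookkeeping: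
abc-iut-L2-d1's `rigidData_lDeltaTheta` + `C.map_toTheta_Huu`). [cite: MochizukiEtTh2009, Cor 2.18 p.59] -/
theorem rigidData_lDeltaTheta_eq_ker_toEll_subgroupOf (μ : D.CyclotomeMod l N) (hC : D.Compat) (hS : D.Sec2Hyps)
    (h15 : Prop15iii E hC) (L : C.CuspLabels) :
    (C.rigidData μ hC hS h15 L).lDeltaTheta = (D.thetaToEll.comp D.toTheta).ker.subgroupOf C.Huu := by
  rw [C.rigidData_lDeltaTheta μ hC hS h15 L, ← D.comap_toTheta_deltaTheta]
  ext x
  simp only [Subgroup.mem_subgroupOf, Subgroup.mem_comap]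
  exact C.toTheta_mem_lDeltaTheta_iff_of_mem_Huu x.2

/-- **[EtTh] Cor. 2.18 (i) for the §1 model `C.rigidData μ hC hS h15 L`, CLAUSE BY CLAUSE**: it HOLDS as soon as the five
subgroups `Π^tp_{Y̲̲}`, `Π^tp_{Ÿ̲̲}`, `Δ^tp_{X̲̲}`, `Ker(Π^tp_{X̲̲} ↠ (Π^tp_X)^Θ)`, `Ker(Π^tp_{X̲̲} ↠ (Π^tp_X)^ell)` of `Π^tp_{X̲̲}` are
characteristic in the topological group `Π^tp_{X̲̲}` and the cusp labels are respected — any theta setting, any `E`, `X̲̲`, `μ`, `L`;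
NO extension to `Π^tp_X` is asked. [cite: MochizukiEtTh2009, Cor 2.18(i) p.60] -/
theorem rigidData_cor218_i_of_isTopCharacteristic (μ : D.CyclotomeMod l N) (hC : D.Compat) (hS : D.Sec2Hyps)
    (h15 : Prop15iii E hC) (L : C.CuspLabels)
    (hY : IsTopCharacteristic C.Huu (D.GtpY.subgroupOf C.Huu))
    (hYdd : IsTopCharacteristic C.Huu (D.GtpYdd.subgroupOf C.Huu))
    (hΔ : IsTopCharacteristic C.Huu (D.DeltaTemp.subgroupOf C.Huu))
    (hΘ : IsTopCharacteristic C.Huu (D.toTheta.ker.subgroupOf C.Huu))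
    (hell : IsTopCharacteristic C.Huu ((D.thetaToEll.comp D.toTheta).ker.subgroupOf C.Huu))
    (hcusp : ∀ (γ : ↥C.Huu ≃ₜ* ↥C.Huu) (a : ZMod l),
      (fun H : Subgroup C.Huu => H.map γ.toMulEquiv.toMonoidHom) '' L.cuspX a = L.cuspX a) :
    (C.rigidData μ hC hS h15 L).Cor218_i := by
  intro γ
  refine ⟨hY γ, hYdd γ, ?_, ?_, ?_, hcusp γ⟩
  · rw [C.rigidData_aug_ker μ hC hS h15 L]
    exact hΔ γ
  · rw [C.rigidData_thetaKer μ hC hS h15 L]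
    exact hΘ γ
  · rw [C.rigidData_lDeltaTheta_eq_ker_toEll_subgroupOf μ hC hS h15 L]
    exact hell γ

end EtaleThetaData.DoubleUnderline

end ThetaSetting

/-! ## §2. At the stage-2 models: the (l·Δ_Θ) clause from the (Θ) and (Δ) clauses -/

namespace SettingModel

open Literature.AnabelianGeometry.SemiGraphs

variable (p : ℕ) [Fact p.Prime] (i j : ℤ)

/-- `n · y = 0` in `ℤ/(n·N)` forces `y ≡ 0 (mod N)`. [folklore] -/
private theorem castHom_eq_zero_of_natCast_mul_eq_zero (n N : ℕ+) (y : ZMod ((n * N : ℕ+) : ℕ))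
    (h : ((n : ℕ) : ZMod ((n * N : ℕ+) : ℕ)) * y = 0) :
    ZMod.castHom (show (N : ℕ) ∣ ((n * N : ℕ+) : ℕ) from ⟨n, by rw [PNat.mul_coe, mul_comm]⟩) (ZMod N) y = 0 := by
  obtain ⟨k, rfl⟩ := ZMod.natCast_zmod_surjective y
  rw [map_natCast, ZMod.natCast_eq_zero_iff]
  rw [← Nat.cast_mul, ZMod.natCast_eq_zero_iff, PNat.mul_coe] at h
  exact Nat.dvd_of_mul_dvd_mul_left n.pos h

/-- **The `⊇` half of the intrinsic description of `Ker(↠ell)`** at the stage-2 models: an element `g ∈ Δ^tp_X` whose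
commutators with `inl η(b)` and with some `inl η(a^n)` die in `(Π^tp_X)^Θ` lies in `Ker(Π^tp_X ↠ (Π^tp_X)^ell)` — in Heisenberg
coordinates `⁅g, b⁆ ↦ (0, 0, x(g))` and `⁅g, a^n⁆ ↦ (0, 0, −n·y(g))` at every level, so `x(g) = 0` and (level `n·N → N`) `y(g) = 0`.
[cite: MochizukiEtTh2009, §1 p.12] -/
theorem mem_ellKerχq_of_commutator_mem_thetaKer (n : ℕ+) {g : PiTpχq p i j} (hg : g.right = 1)
    (hb : ⁅g, SemidirectProduct.inl (gfpOf (FreeGroup.of 1))⁆ ∈ CurveTheta.thetaKer (curveχq p i j))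
    (ha : ⁅g, SemidirectProduct.inl (gfpOf (FreeGroup.of 0 ^ ((n : ℕ) : ℤ)))⁆ ∈ CurveTheta.thetaKer (curveχq p i j)) :
    g ∈ CurveTheta.ellKer (curveχq p i j) := by
  rw [eq_inl_of_right_eq_oneq p i j hg, ← map_commutatorElement, mem_thetaKerχq_iff, SemidirectProduct.left_inl] at hb ha
  -- `x ≡ 0` at every level, from the commutator with `b`
  have hx : ∀ M : ℕ+, (levelHom M g.left).x = 0 := fun M => by
    have h := congrArg Heis.z (hb.1 M)
    change (levelHom M ⁅g.left, gfpOf (FreeGroup.of 1)⁆).z = (1 : Heis (ZMod M)).z at h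
    rw [map_commutatorElement, levelHom_gfpOf, heisHom_of_one, Heis.commutatorElement_eq] at h
    simpa using h
  -- `n · y ≡ 0` at every level, from the commutator with `a^n`
  have hny : ∀ M : ℕ+, ((n : ℕ) : ZMod M) * (levelHom M g.left).y = 0 := fun M => by
    have h := congrArg Heis.z (ha.1 M)
    change (levelHom M ⁅g.left, gfpOf (FreeGroup.of 0 ^ ((n : ℕ) : ℤ))⁆).z = (1 : Heis (ZMod M)).z at h
    rw [map_commutatorElement, levelHom_gfpOf_of_zero_zpow, Heis.commutatorElement_eq] at h
    simp only [mul_zero, zero_sub, Heis.one_z, neg_eq_zero, Int.cast_natCast] at h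
    exact h
  rw [mem_ellKerχq_iff, eq_inl_of_right_eq_oneq p i j hg, SemidirectProduct.left_inl, SemidirectProduct.right_inl]
  refine ⟨fun M => ⟨hx M, ?_⟩, rfl⟩
  -- `y ≡ 0 (mod M)` from `n · y ≡ 0 (mod n·M)`
  have hdvd : (M : ℕ) ∣ ((n * M : ℕ+) : ℕ) := ⟨n, by rw [PNat.mul_coe, mul_comm]⟩
  have hred : (hHat M (gfpFst g.left)).y = ZMod.castHom hdvd (ZMod M) (levelHom (n * M) g.left).y := by
    rw [← map_hHat_of_dvd hdvd (gfpFst g.left), Heis.map_apply]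
    rfl
  change (hHat M (gfpFst g.left)).y = 0
  rw [hred]
  exact castHom_eq_zero_of_natCast_mul_eq_zero n M _ (hny (n * M))

variable (hj : Even j)

/-- **(Θ) ∧ (Δ) ⟹ (l·Δ_Θ) at the stage-2 models.**  For EVERY étale-theta datum `E` over `ThetaSetting.modelχq p i j hj` and
EVERY `X̲̲`-choice `C` whose `Π^tp_{X̲̲}` contains `inl η(b)` and some `inl η(a^n)` (e.g. the choice of record `Huuχq`, `n = l`):
if `Δ^tp_{X̲̲} = Δ^tp_X ∩ Π^tp_{X̲̲}` and `Ker(Π^tp_{X̲̲} ↠ (Π^tp_X)^Θ)` are characteristic in the topological group `Π^tp_{X̲̲}`, then so is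
`Ker(Π^tp_{X̲̲} ↠ (Π^tp_X)^ell)` — because INTRINSICALLY `Ker(↠ell) ∩ Π^tp_{X̲̲} = {g ∈ Δ^tp_{X̲̲} | ∀ h ∈ Δ^tp_{X̲̲}, ⁅g, h⁆ ∈ Ker(↠Θ)}`
(`⊆`: `Δ_Θ` is central in `Δ^Θ_X`, root axiom `ker_thetaToEll_central`; `⊇`: `mem_ellKerχq_of_commutator_mem_thetaKer`).
[cite: MochizukiEtTh2009, Cor 2.18(i) p.60] -/
theorem isTopCharacteristic_ker_toEll_subgroupOf_Huu_modelχq_of_thetaKer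
    {E : (ThetaSetting.modelχq p i j hj).EtaleThetaData} {l : ℕ} (C : E.DoubleUnderline l) (n : ℕ+)
    (hbC : (SemidirectProduct.inl (gfpOf (FreeGroup.of 1)) : PiTpχq p i j) ∈ C.Huu)
    (haC : (SemidirectProduct.inl (gfpOf (FreeGroup.of 0 ^ ((n : ℕ) : ℤ))) : PiTpχq p i j) ∈ C.Huu)
    (hΔ : IsTopCharacteristic C.Huu ((ThetaSetting.modelχq p i j hj).DeltaTemp.subgroupOf C.Huu))
    (hΘ : IsTopCharacteristic C.Huu ((ThetaSetting.modelχq p i j hj).toTheta.ker.subgroupOf C.Huu)) :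
    IsTopCharacteristic C.Huu
      (((ThetaSetting.modelχq p i j hj).thetaToEll.comp (ThetaSetting.modelχq p i j hj).toTheta).ker.subgroupOf C.Huu) := by
  -- the two kernels of the record are `CurveTheta.ellKer` / `CurveTheta.thetaKer` of `curveχq`
  have hkerE : ((ThetaSetting.modelχq p i j hj).thetaToEll.comp (ThetaSetting.modelχq p i j hj).toTheta).ker =
      CurveTheta.ellKer (curveχq p i j) := CurveTheta.ker_toEll (curveχq p i j)
  have hkerT : (ThetaSetting.modelχq p i j hj).toTheta.ker = CurveTheta.thetaKer (curveχq p i j) :=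
    QuotientGroup.ker_mk' _
  rw [hkerE]
  rw [hkerT] at hΘ
  -- the intrinsic description of `Ker(↠ell) ∩ Π^tp_{X̲̲}`
  have key : ∀ x : C.Huu, x ∈ (CurveTheta.ellKer (curveχq p i j)).subgroupOf C.Huu ↔
      x ∈ (curveχq p i j).DeltaTemp.subgroupOf C.Huu ∧
        ∀ h ∈ (curveχq p i j).DeltaTemp.subgroupOf C.Huu,
          ⁅x, h⁆ ∈ (CurveTheta.thetaKer (curveχq p i j)).subgroupOf C.Huu := by
    intro x
    simp only [Subgroup.mem_subgroupOf, Subgroup.coe_mul, Subgroup.coe_inv, commutatorElement_def]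
    constructor
    · intro hx
      refine ⟨CurveTheta.ellKer_le_deltaTemp _ hx, fun h hh => ?_⟩
      rw [← commutatorElement_def]
      exact CurveTheta.commutatorElement_mem_thetaKer _ hx (CurveTheta.toHat_mem_deltaHat_of_mem_deltaTemp _ hh)
    · rintro ⟨hx, hcomm⟩
      have hg : (x : PiTpχq p i j).right = 1 := (mem_deltaTempχq_iff p i j _).mp hx
      refine mem_ellKerχq_of_commutator_mem_thetaKer p i j n hg ?_ ?_
      · have h := hcomm ⟨_, hbC⟩ (by
          change (SemidirectProduct.inl (gfpOf (FreeGroup.of 1)) : PiTpχq p i j) ∈ (curveχq p i j).DeltaTemp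
          exact (mem_deltaTempχq_iff p i j _).mpr (SemidirectProduct.right_inl _))
        rwa [← commutatorElement_def] at h
      · have h := hcomm ⟨_, haC⟩ (by
          change (SemidirectProduct.inl (gfpOf (FreeGroup.of 0 ^ ((n : ℕ) : ℤ))) : PiTpχq p i j) ∈ (curveχq p i j).DeltaTemp
          exact (mem_deltaTempχq_iff p i j _).mpr (SemidirectProduct.right_inl _))
        rwa [← commutatorElement_def] at h
  -- one inclusion for every `φ`, then `φ.symm`
  have hle : ∀ φ : ↥C.Huu ≃ₜ* ↥C.Huu,
      ((CurveTheta.ellKer (curveχq p i j)).subgroupOf C.Huu).map φ.toMulEquiv.toMonoidHom ≤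
        (CurveTheta.ellKer (curveχq p i j)).subgroupOf C.Huu := by
    intro φ
    rintro _ ⟨x, hx, rfl⟩
    change φ x ∈ _
    replace hx : x ∈ (CurveTheta.ellKer (curveχq p i j)).subgroupOf C.Huu := hx
    rw [key] at hx ⊢
    refine ⟨?_, fun h hh => ?_⟩
    · rw [← hΔ φ]
      exact ⟨x, hx.1, rfl⟩
    · have hh' : φ.symm h ∈ (curveχq p i j).DeltaTemp.subgroupOf C.Huu := by
        rw [← hΔ φ] at hh
        obtain ⟨y, hy, hyh⟩ := hh
        have : φ.symm h = y := by rw [← hyh]; exact φ.symm_apply_apply y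
        rw [this]
        exact hy
      have hc := hx.2 _ hh'
      have e : ⁅φ x, h⁆ = φ ⁅x, φ.symm h⁆ := by
        rw [map_commutatorElement, ContinuousMulEquiv.apply_symm_apply]
      rw [e, ← hΘ φ]
      exact ⟨_, hc, rfl⟩
  intro φ
  refine le_antisymm (hle φ) fun x hx => ⟨φ.symm x, hle φ.symm ⟨x, hx, rfl⟩, φ.apply_symm_apply x⟩

/-! ## §3. F-0620 at the stage-2 models from (Δ) ∧ hcharY ∧ hΘ; at the Tate model's choice of record from hcharY ∧ hΘ -/

open Literature.IUT.HodgeArakelov Literature.IUT.HodgeArakelov.ModelTateCarriers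

/-- **F-0620 `Cor218_i` at `ThetaSetting.modelχq p i j hj` (empty cusp labelling) ⟸ (Δ) ∧ hcharY ∧ hΘ** — every prime `p`,
every `(i, j)` with `j` even, every `E`, every `X̲̲`-choice `C` containing `inl η(b)` and some `inl η(a^n)`, every level `μ`:
(Y̲̲) is abc-iut-w5-d233's theorem, (Ÿ̲̲) IS (H1) `hcharY` (abc-iut-w6-d055), (l·Δ_Θ) is §2, (cusps) is vacuous.  NO extension hypothesis.
[cite: MochizukiEtTh2009, Cor 2.18(i) p.60] -/
theorem rigidData_cor218_i_modelχq_of_piYddCharacteristic_of_thetaKer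
    {E : (ThetaSetting.modelχq p i j hj).EtaleThetaData} {l : ℕ} (C : E.DoubleUnderline l) {N : ℕ+}
    (μ : (ThetaSetting.modelχq p i j hj).CyclotomeMod l N) (hC : (ThetaSetting.modelχq p i j hj).Compat)
    (hS : (ThetaSetting.modelχq p i j hj).Sec2Hyps) (h15 : ThetaSetting.Prop15iii E hC) (n : ℕ+)
    (hbC : (SemidirectProduct.inl (gfpOf (FreeGroup.of 1)) : PiTpχq p i j) ∈ C.Huu)
    (haC : (SemidirectProduct.inl (gfpOf (FreeGroup.of 0 ^ ((n : ℕ) : ℤ))) : PiTpχq p i j) ∈ C.Huu)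
    (hΔ : IsTopCharacteristic C.Huu ((ThetaSetting.modelχq p i j hj).DeltaTemp.subgroupOf C.Huu))
    (hcharY : EtaleThetaDataOfSetting.PiYddCharacteristic C)
    (hΘ : IsTopCharacteristic C.Huu ((ThetaSetting.modelχq p i j hj).toTheta.ker.subgroupOf C.Huu)) :
    (C.rigidData μ hC hS h15 ⟨fun _ => ∅, fun _ => ∅, fun _ => rfl⟩).Cor218_i :=
  C.rigidData_cor218_i_of_isTopCharacteristic μ hC hS h15 _
    (isTopCharacteristic_GtpY_subgroupOf_Huu_modelχq p i j hj C)
    ((piYddCharacteristic_iff_isTopCharacteristic C).mp hcharY) hΔ hΘ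
    (isTopCharacteristic_ker_toEll_subgroupOf_Huu_modelχq_of_thetaKer p i j hj C n hbC haC hΔ hΘ)
    (fun _ _ => Set.image_empty _)

end SettingModel

end Literature.AnabelianGeometry.EtaleTheta

namespace Literature.IUT.HodgeArakelov

open Literature.AnabelianGeometry.EtaleTheta Literature.AnabelianGeometry.SemiGraphs
open Literature.AnabelianGeometry.EtaleTheta.SettingModel
open scoped Literature.AnabelianGeometry.EtaleTheta
open EtaleThetaDataOfSetting

namespace ModelTateCarriers

variable (p : ℕ) [Fact p.Prime] (l : ℕ+) (hl : Odd (l : ℕ)) (hlp : (l : ℕ).Prime) (hdvd : 4 * (l : ℕ) ∣ p - 1)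
  {Es : Set ℕ+} (τ : (ThetaSetting.modelχq p 1 2 even_two).CyclotomeTower l Es)

include hlp hdvd in
/-- **F-0620 [EtTh] Cor. 2.18 (i) at EVERY level `τ.modAll M` of the rigidity data OF RECORD of the Tate model ⟸ hcharY ∧ hΘ** —
abc-iut-L6-t2's `levelRigid_cor218_i_modelTate_of_extends` (p490266) with `hextΔ` REPLACED by {(H1) `hcharY` (already a binder of
the Cor. 1.12 display), `hΘ` (one conjunct of F-0620 itself)}; the (Δ) clause is abc-iut-w4-d044's theorem
`deltaX_characteristic_ofDoubleUnderline_modelχq_holds` (p488629) read through the Thm 5.10 bridge.  Every prime `p` of the record.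
[cite: MochizukiEtTh2009, Cor 2.18(i) p.60] -/
theorem levelRigid_cor218_i_modelTate_of_piYddCharacteristic_of_thetaKer :
    let hC := compat_modelχq p 1 2 even_two
    let hS := ThetaSetting.modelχq_sec2Hyps p 1 2 even_two
    let K₀ := (kummerCoreχq p 1 2 even_two).toKummerDataOfSection SemidirectProduct.inr (continuous_inrχq p 1 2)
        (fun _ => rfl) (map_inr_GK_le_GtpY_modelχq' p 1 2 even_two) (map_inr_GKdd_le_GtpYdd_modelχq' p 1 2 even_two)
    let C := (K₀.etaleThetaDataOfClass (etaDdχq p 1 2 even_two)).doubleUnderlineχqOfEtaRes p 1 2 l hl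
        (eta_res_etaDdχq p 1 2 even_two l hl)
    let h15 : Literature.AnabelianGeometry.EtaleTheta.ThetaSetting.Prop15iii _ hC :=
      prop15iii_etaleThetaDataOfClass_etaDdχq p hC SemidirectProduct.inr
        (continuous_inrχq p 1 2) (fun _ => rfl) (map_inr_GK_le_GtpY_modelχq' p 1 2 even_two)
        (map_inr_GKdd_le_GtpYdd_modelχq' p 1 2 even_two)
    let L : C.CuspLabels := ⟨fun _ => ∅, fun _ => ∅, fun _ => rfl⟩
    ∀ (_hcharY : EtaleThetaDataOfSetting.PiYddCharacteristic C)
      (_hΘ : IsTopCharacteristic C.Huu ((ThetaSetting.modelχq p 1 2 even_two).toTheta.ker.subgroupOf C.Huu))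
      (M : ℕ+), (EtaleLevels.levelRigid C hC hS τ.modAll h15 L M).Cor218_i := by
  intro hC hS K₀ C h15 L hcharY hΘ M
  have hp2 := ne_two_of_four_mul_dvd_pred p l.pos hdvd
  have hpl := ne_of_four_mul_dvd_pred p l.pos hdvd
  have hζ := exists_isPrimitiveRoot_K_modelχq p 1 2 even_two l.pos hdvd
  have hΔ : IsTopCharacteristic C.Huu ((ThetaSetting.modelχq p 1 2 even_two).DeltaTemp.subgroupOf C.Huu) :=
    C.isTopCharacteristic_deltaTemp_subgroupOf_Huu_of_deltaX_ofDoubleUnderline (τ.modAll M) hC hS hlp hp2 hpl hζ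
      (EtaleLevels.eta0_mem C hC hS τ.modAll (EtaleThetaDataOfSetting.rootLift C) (rootLift_mem_rootCocycles C hC) M)
      (deltaX_characteristic_ofDoubleUnderline_modelχq_holds p 1 2 even_two C (τ.modAll M) hC hS hlp hp2 hpl hζ
        (EtaleLevels.eta0_mem C hC hS τ.modAll (EtaleThetaDataOfSetting.rootLift C) (rootLift_mem_rootCocycles C hC) M))
  exact rigidData_cor218_i_modelχq_of_piYddCharacteristic_of_thetaKer p 1 2 even_two C (τ.modAll M) hC hS h15 l
    (inl_gfpOf_of_one_mem_Huuχq p 1 2 l hl) (inl_gfpOf_zpow_mem_Huuχq p 1 2 l hl) hΔ hcharY hΘ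

/-! ## §4. The binder's type, certified (kernel `example`): `h218i₁` of p477403 / p492626 IS the `M = 1` instance -/

include hlp hdvd in
/-- F-0620 AT LEVEL `1` in the literal currency of the `h218i₁` binder of `cor112_model_modelTate_section_translates`
(p477403) / `…_unconditional` (p492626): `(C.rigidData (τ.modAll 1) hC hS h15 L).Cor218_i` from hcharY ∧ hΘ — so the consumer term
`cor112_model_modelTate_section_translates_unconditional p l hl hlp hdvd τ hP (THIS) hcharY huniq G` has displayed binders
{`hP`, `hcharY`, `hΘ`, `huniq`, `G`}. [cite: MochizukiEtTh2009, Cor 2.18(i) p.60] -/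
example :
    let hC := compat_modelχq p 1 2 even_two
    let hS := ThetaSetting.modelχq_sec2Hyps p 1 2 even_two
    let K₀ := (kummerCoreχq p 1 2 even_two).toKummerDataOfSection SemidirectProduct.inr (continuous_inrχq p 1 2)
        (fun _ => rfl) (map_inr_GK_le_GtpY_modelχq' p 1 2 even_two) (map_inr_GKdd_le_GtpYdd_modelχq' p 1 2 even_two)
    let C := (K₀.etaleThetaDataOfClass (etaDdχq p 1 2 even_two)).doubleUnderlineχqOfEtaRes p 1 2 l hl
        (eta_res_etaDdχq p 1 2 even_two l hl)
    let h15 : Literature.AnabelianGeometry.EtaleTheta.ThetaSetting.Prop15iii _ hC :=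
      prop15iii_etaleThetaDataOfClass_etaDdχq p hC SemidirectProduct.inr
        (continuous_inrχq p 1 2) (fun _ => rfl) (map_inr_GK_le_GtpY_modelχq' p 1 2 even_two)
        (map_inr_GKdd_le_GtpYdd_modelχq' p 1 2 even_two)
    let L : C.CuspLabels := ⟨fun _ => ∅, fun _ => ∅, fun _ => rfl⟩
    ∀ (_hcharY : EtaleThetaDataOfSetting.PiYddCharacteristic C)
      (_hΘ : IsTopCharacteristic C.Huu ((ThetaSetting.modelχq p 1 2 even_two).toTheta.ker.subgroupOf C.Huu)),
      (C.rigidData (τ.modAll 1) hC hS h15 L).Cor218_i := by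
  intro hC hS K₀ C h15 L hcharY hΘ
  exact levelRigid_cor218_i_modelTate_of_piYddCharacteristic_of_thetaKer p l hl hlp hdvd τ hcharY hΘ 1

end ModelTateCarriers

end Literature.IUT.HodgeArakelov

end
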